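import Summits.FinalStateConjecture.FinalStateConjecture.Theses.StarvedNecks
import Literature.Geometry.Lorentzian.KerrConvergenceProofs

/-!
# Route StarvedNecks · item `KerrSchildTailDecay` (stmt-FinalStateConjecture-13553)

The route decl
`Summit.FinalStateConjecture.FinalStateConjecture.Theses.StarvedNecks.KerrSchildTailDecay` reads:
for sub-extremal Kerr parameters `(M, a)` (`|a| < M`) there is `C` with
`supCkENorm {x | ρ ≤ r(x)} 2 (g_{M,a} − η) ≤ C/ρ` for every `ρ ≥ 4M` — the `C²` sup norm of the
Kerr–Schild perturbation `g_{M,a} − η = 2H ℓ ⊗ ℓ` over the far region `{r ≥ ρ}` decays like `1/ρ`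
(Kerr–Schild 1965, §2–§3; Visser arXiv:0706.0622, (32)–(35): `H = Mr³/(r⁴ + a²z²) ≤ M/r`,
`D^m ℓ = O(r^{-m})`).

Proof. The tree already proves the decay of ALL derivatives of the Kerr–Schild term by scaling
(`Kerr.norm_iteratedFDeriv_ksPert_le`, `KerrConvergenceProofs.lean`: `‖D^m (g_{M,a} − η)(x)‖ ≤ C_m/r(x)`
for `r(x) ≥ R_m`), but with the threshold `R_m` hidden behind an existential. Here the same
scaling argument is re-run with an EXPLICIT threshold: for every `R₀ > 0` with `2|a| ≤ R₀` and every
order `m` there is `C ≥ 0` with `‖D^m (g_{M,a} − η)(x)‖ ≤ C/r(x)` whenever `r(x) ≥ R₀`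
(`norm_iteratedFDeriv_ksPert_le_of_two_mul_abs_le`): with `ε = 1/‖x⃗‖ ≤ 1/R₀`,
`(g_{M,a} − η) = ε M (g_{1,εa} − η) ∘ (ε ·)` (`Kerr.ksPert_smul`), so
`‖D^m (g_{M,a} − η)(x)‖ ≤ ε^{m+1} |M| ‖D^m (g_{1,εa} − η)(εx)‖ ≤ ε |M| R₀^{-m} B_m`, `B_m` the bound of
`Kerr.exists_bound_iteratedFDeriv_ksPert_one` on the unit shell (`|εa| ≤ 1/2`, after a time
translation to `x⁰ = 0`, `Kerr.iteratedFDeriv_ksPert_eq_of_spatial_eq`), and `ε ≤ 1/r(x)`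
(`Kerr.radius_le_spatialNorm`). For sub-extremal `(M, a)` the threshold `R₀ = 4M > 2|a|` is
admissible, and the `C²` sup norm over `{r ≥ ρ}`, `ρ ≥ 4M`, is bounded by
`(C₀ + C₁ + C₂)/r ≤ (C₀ + C₁ + C₂)/ρ` pointwise (`kerrSchildTailDecay_proof`).

References: R. P. Kerr, A. Schild (1965), §2–§3 (key `KerrSchild1965`); M. Visser,
arXiv:0706.0622, (32)–(35); M. Dafermos, G. Holzegel, I. Rodnianski, M. Taylor, arXiv:2104.08222,
§1 (the unweighted `Cᵏ` norms of the metric deviation). Mathlib + tree lemmas only; no named facts.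
-/

noncomputable section

-- the summit and its single sub-problem share the name `FinalStateConjecture` (D-0017 layout)
set_option linter.dupNamespace false

open Set Filter Function
open scoped ContDiff ENNReal Topology
open Literature.Geometry.Lorentzian

namespace Summit.FinalStateConjecture.FinalStateConjecture.Theorems

-- the algebraic and the operator-norm instance paths on `E4 →L[ℝ] E4 →L[ℝ] ℝ` unify slowly
set_option synthInstance.maxHeartbeats 200000 in
/-- **Decay of all derivatives of the Kerr–Schild perturbation, explicit threshold.** For
`R₀ > 0` with `2|a| ≤ R₀` and every order `m` there is `C ≥ 0` with
`‖D^m (g_{M,a} − η)(x)‖ ≤ C / r(x)` whenever `r(x) ≥ R₀` (the scaling proof of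
`Kerr.norm_iteratedFDeriv_ksPert_le` with `ε = 1/‖x⃗‖ ≤ 1/R₀`, so that `|ε|^m ≤ R₀^{-m}` replaces
`|ε|^m ≤ 1`). Kerr–Schild 1965, §2–§3 (asymptotic flatness of the Kerr–Schild form); Visser
arXiv:0706.0622, (32)–(35). [cite: KerrSchild1965, §3] -/
theorem norm_iteratedFDeriv_ksPert_le_of_two_mul_abs_le {R₀ a : ℝ} (hR₀ : 0 < R₀)
    (ha : 2 * |a| ≤ R₀) (M : ℝ) (m : ℕ) :
    ∃ C : ℝ, 0 ≤ C ∧ ∀ x : E4, R₀ ≤ Kerr.radius a x →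
      ‖iteratedFDeriv ℝ m (fun y ↦ Kerr.bilin M a y - Minkowski.bilin) x‖ ≤ C / Kerr.radius a x := by
  obtain ⟨B, hB⟩ := Kerr.exists_bound_iteratedFDeriv_ksPert_one m
  have hB0 : 0 ≤ max B 0 := le_max_right _ _
  have hC0 : 0 ≤ |M| * max B 0 * R₀⁻¹ ^ m :=
    mul_nonneg (mul_nonneg (abs_nonneg _) hB0) (pow_nonneg (inv_nonneg.mpr hR₀.le) m)
  refine ⟨|M| * max B 0 * R₀⁻¹ ^ m, hC0, fun x hx ↦ ?_⟩
  set s := E4.spatialNorm x with hs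
  have hr0 : 0 < Kerr.radius a x := hR₀.trans_le hx
  have hrs : Kerr.radius a x ≤ s := Kerr.radius_le_spatialNorm a x
  have hsR : R₀ ≤ s := hx.trans hrs
  have hs0 : 0 < s := hR₀.trans_le hsR
  have hsa : 2 * |a| ≤ s := ha.trans hsR
  set ε := s⁻¹ with hε
  have hε0 : 0 < ε := inv_pos.mpr hs0
  have hεR : ε ≤ R₀⁻¹ := inv_anti₀ hR₀ hsR
  -- zero the time coordinate
  set x' : E4 := x - x 0 • E4.basisVector 0 with hx'
  have hsp : E4.spatial x = E4.spatial x' := by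
    have h0 : E4.spatial (E4.basisVector 0) = 0 := by
      ext i
      simp [E4.spatial_apply]
    rw [hx', map_sub, map_smul, h0, smul_zero, sub_zero]
  have hder := Kerr.iteratedFDeriv_ksPert_eq_of_spatial_eq M a m hsp
  have hrx' : Kerr.radius a x' = Kerr.radius a x := (Kerr.radius_eq_of_spatial_eq a hsp).symm
  have hsx' : E4.spatialNorm x' = s := by rw [hs, E4.spatialNorm, E4.spatialNorm, hsp]
  -- the rescaled point on the unit shell
  set y : E4 := ε • x' with hy
  have hy0 : y 0 = 0 := by simp [hy, hx']
  have hy1 : E4.spatialNorm y = 1 := by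
    rw [hy, Kerr.spatialNorm_smul, abs_of_pos hε0, hsx', hε, inv_mul_cancel₀ hs0.ne']
  have ha' : |ε * a| ≤ 1 / 2 := by
    rw [abs_mul, abs_of_pos hε0, hε, inv_mul_le_iff₀ hs0]
    linarith
  have hry : 0 < Kerr.radius (ε * a) y := by
    rw [hy, Kerr.radius_smul hε0, hrx']
    exact mul_pos hε0 hr0
  -- scaling of the iterated derivative
  have hfun : (fun y ↦ Kerr.bilin M a y - Minkowski.bilin) =
      fun z ↦ (ε * M) • (Kerr.bilin 1 (ε * a) (ε • z) - Minkowski.bilin) :=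
    funext fun z ↦ Kerr.ksPert_smul hε0 M a z
  have hkey := norm_iteratedFDeriv_const_smul_comp_smul_le
    (fun y ↦ Kerr.bilin 1 (ε * a) y - Minkowski.bilin) (ε * M) hε0.ne' x' (m := m)
    (Kerr.contDiffAt_ksPert (M := 1) hry)
  have hεm : |ε| ^ m ≤ R₀⁻¹ ^ m := by
    rw [abs_of_pos hε0]
    exact pow_le_pow_left₀ hε0.le hεR m
  calc (‖iteratedFDeriv ℝ m (fun y ↦ Kerr.bilin M a y - Minkowski.bilin) x‖ : ℝ)
        = (‖iteratedFDeriv ℝ m (fun y ↦ Kerr.bilin M a y - Minkowski.bilin) x'‖ : ℝ) := by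
        rw [hder]
    _ = (‖iteratedFDeriv ℝ m
          (fun z ↦ (ε * M) • (Kerr.bilin 1 (ε * a) (ε • z) - Minkowski.bilin)) x'‖ : ℝ) := by
        rw [← hfun]
    _ ≤ |ε * M| * |ε| ^ m *
          (‖iteratedFDeriv ℝ m (fun y ↦ Kerr.bilin 1 (ε * a) y - Minkowski.bilin) y‖ : ℝ) := hkey
    _ ≤ |ε * M| * R₀⁻¹ ^ m * max B 0 :=
        mul_le_mul (mul_le_mul_of_nonneg_left hεm (abs_nonneg _))
          ((hB _ ha' y hy0 hy1).trans (le_max_left _ _)) (norm_nonneg _)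
          (mul_nonneg (abs_nonneg _) (pow_nonneg (inv_nonneg.mpr hR₀.le) m))
    _ = ε * (|M| * max B 0 * R₀⁻¹ ^ m) := by
        rw [abs_mul, abs_of_pos hε0]
        ring
    _ ≤ (Kerr.radius a x)⁻¹ * (|M| * max B 0 * R₀⁻¹ ^ m) :=
        mul_le_mul_of_nonneg_right (inv_anti₀ hr0 hrs) hC0
    _ = |M| * max B 0 * R₀⁻¹ ^ m / Kerr.radius a x := by rw [div_eq_inv_mul]

/-- **Item `KerrSchildTailDecay` (stmt-FinalStateConjecture-13553), proved.** For sub-extremal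
`(M, a)` there is `C` with `supCkENorm {x | ρ ≤ r(x)} 2 (g_{M,a} − η) ≤ C/ρ` for all `ρ ≥ 4M`:
since `|a| < M`, the threshold `R₀ = 4M > 2|a|` is admissible in
`norm_iteratedFDeriv_ksPert_le_of_two_mul_abs_le` for `m = 0, 1, 2`, and pointwise on `{r ≥ ρ}`
`‖D^m (g_{M,a} − η)(x)‖ ≤ C_m/r(x) ≤ (C₀ + C₁ + C₂)/ρ`. Kerr–Schild 1965, §2–§3; Visser
arXiv:0706.0622, (32)–(35); DHRT arXiv:2104.08222, §1. [cite: KerrSchild1965, §3] -/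
theorem kerrSchildTailDecay_proof :
    Summit.FinalStateConjecture.FinalStateConjecture.Theses.StarvedNecks.KerrSchildTailDecay := by
  intro M a hMa
  have hM : 0 < M := hMa.pos
  have haM : |a| < M := hMa
  have hR₀ : (0 : ℝ) < 4 * M := by positivity
  have h2a : 2 * |a| ≤ 4 * M := by linarith [abs_nonneg a]
  obtain ⟨C₀, hC₀, h₀⟩ := norm_iteratedFDeriv_ksPert_le_of_two_mul_abs_le hR₀ h2a M 0
  obtain ⟨C₁, hC₁, h₁⟩ := norm_iteratedFDeriv_ksPert_le_of_two_mul_abs_le hR₀ h2a M 1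
  obtain ⟨C₂, hC₂, h₂⟩ := norm_iteratedFDeriv_ksPert_le_of_two_mul_abs_le hR₀ h2a M 2
  refine ⟨C₀ + C₁ + C₂, fun ρ hρ ↦ ?_⟩
  have hρ0 : 0 < ρ := hR₀.trans_le hρ
  refine iSup₂_le fun m hm ↦ iSup₂_le fun x hx ↦ ?_
  have hxρ : ρ ≤ Kerr.radius a x := hx
  have hr : 4 * M ≤ Kerr.radius a x := hρ.trans hxρ
  have hr0 : 0 < Kerr.radius a x := hρ0.trans_le hxρ
  have hsum : ∀ C : ℝ, C ≤ C₀ + C₁ + C₂ →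
      C / Kerr.radius a x ≤ (C₀ + C₁ + C₂) / ρ := fun C hC ↦
    (div_le_div_of_nonneg_right hC hr0.le).trans
      (div_le_div_of_nonneg_left (by linarith) hρ0 hxρ)
  refine enorm_le_ofReal_of_norm_le ?_
  interval_cases m
  · exact (h₀ x hr).trans (hsum C₀ (by linarith))
  · exact (h₁ x hr).trans (hsum C₁ (by linarith))
  · exact (h₂ x hr).trans (hsum C₂ (by linarith))

end Summit.FinalStateConjecture.FinalStateConjecture.Theorems

end
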